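import Mathlib
import HarnessLib
import Literature.MathematicalPhysics.StatisticalMechanics.ActivitySpace

/-!
# The norm-bound predicates are CLOSED FROM ABOVE in the bound
# ([ABKM19] Ch. 6.4 (6.48)–(6.50), Ch. 12 (12.2): `‖K‖ ≤ c' for all c' > c` implies `‖K‖ ≤ c`)

The fine-tuning engine with norm-bound predicates
(`Literature.Dynamics.Hyperbolic.RGFlowStableManifoldSecondDiffIterate.distQ_le_of_isTunedQ`,
`….secondDiff_le_of_isTunedQ`) obtains its limiting bounds on the irrelevant coordinates under the
hypothesis
`hQc : ∀ k (y : F k) (c : ℝ), (∀ c', c < c' → Q k y c') → Q k y c`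
("the predicate `Q k y ·` is closed from above").  For the predicates of the tree — `TayNormLE`
(`‖K‖_{T,w} ≤ C`, pointwise `tayNorm T r₀ K φ ≤ C · w φ`), the polymer-norm predicates `WeakNormLE`,
`MidNormLE` (`‖K‖_k^{(A)} ≤ C`, `‖K‖_{k:k+1}^{(A)} ≤ C`), and the engine's `activityNormLE P` on the
activity spaces — this is immediate, since each is a family of genuine inequalities `lhs ≤ C · (factor)`
and `C ↦ C · (factor)` is continuous.  This file records exactly these closure statements:

* `TayNormLE.of_forall_lt`, `WeakNormLE.of_forall_lt`, `MidNormLE.of_forall_lt`;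
* **`activityNormLE_of_forall_lt`** — the hypothesis `hQc` of the engine for `Q = activityNormLE P`
  (any `NormParams`; no sign condition on `A` is needed).

Everything is proved; no named fact.

## References
* S. Adams, S. Buchholz, R. Kotecký, S. Müller, arXiv:1910.13564, Ch. 6.4 (6.48)–(6.50), Ch. 12 (12.2)
  [AdamsBuchholzKoteckyMuller2019].
-/

noncomputable section

namespace Literature.MathematicalPhysics.StatisticalMechanics.GradientRG

open Filter
open _root_.Topology
open Literature.Dynamics.Hyperbolic

/-! ## A real inequality closed from above -/

/-- If `a ≤ c' · b` for every `c' > c`, then `a ≤ c · b` (let `c' ↓ c`; no sign condition on `b`).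
[folklore] -/
private theorem le_mul_of_forall_lt_mul {a b c : ℝ} (h : ∀ c', c < c' → a ≤ c' * b) : a ≤ c * b := by
  have hlim : Tendsto (fun c' : ℝ => c' * b) (𝓝[>] c) (𝓝 (c * b)) :=
    ((continuous_id.mul continuous_const).tendsto c).mono_left nhdsWithin_le_nhds
  exact ge_of_tendsto hlim (eventually_nhdsWithin_of_forall fun c' hc' => h c' hc')

/-! ## The weighted Taylor-norm predicate -/

section TayNorm

variable {E V : Type*} [NormedAddCommGroup E] [NormedSpace ℝ E]
  [NormedAddCommGroup V] [NormedSpace ℝ V]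
  {𝔸 : Type*} [NormedRing 𝔸] [NormedAlgebra ℝ 𝔸]

/-- **`TayNormLE` is closed from above in the constant**: if `‖K‖_{T,w} ≤ C'` for every `C' > C`
then `‖K‖_{T,w} ≤ C`. [cite: AdamsBuchholzKoteckyMuller2019, Ch. 6.4 (6.48)] -/
theorem TayNormLE.of_forall_lt {T : E →ₗ[ℝ] V} {r₀ : ℕ} {w : E → ℝ} {K : E → 𝔸} {C : ℝ}
    (h : ∀ C', C < C' → TayNormLE T r₀ w K C') : TayNormLE T r₀ w K C :=
  fun φ => le_mul_of_forall_lt_mul fun C' hC' => h C' hC' φ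

end TayNorm

/-! ## The polymer-norm predicates -/

section Polymer

variable {d M : ℕ} [NeZero M] {P : NormParams d M} {k : ℕ}
  {K : Finset (Fin d → ZMod M) → ((Fin d → ZMod M) → ℝ) → ℂ} {C : ℝ}

/-- **`WeakNormLE` is closed from above in the constant**: if `‖K‖_k^{(A)} ≤ C'` for every `C' > C`
then `‖K‖_k^{(A)} ≤ C`. [cite: AdamsBuchholzKoteckyMuller2019, Ch. 6.4 (6.50)] -/
theorem WeakNormLE.of_forall_lt (h : ∀ C', C < C' → WeakNormLE P k K C') : WeakNormLE P k K C := by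
  intro X hX hc φ
  have e : ∀ C'' : ℝ, C'' * P.aFactor k X * P.W.weight k X φ = C'' * (P.aFactor k X * P.W.weight k X φ) :=
    fun C'' => mul_assoc _ _ _
  rw [e]
  exact le_mul_of_forall_lt_mul fun C' hC' => by rw [← e]; exact h C' hC' X hX hc φ

/-- **`MidNormLE` is closed from above in the constant**: if `‖K‖_{k:k+1}^{(A)} ≤ C'` for every
`C' > C` then `‖K‖_{k:k+1}^{(A)} ≤ C`. [cite: AdamsBuchholzKoteckyMuller2019, Ch. 6.4 (6.49)] -/
theorem MidNormLE.of_forall_lt (h : ∀ C', C < C' → MidNormLE P k K C') : MidNormLE P k K C := by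
  intro X hX hc φ
  have e : ∀ C'' : ℝ, C'' * P.aFactor k X * P.W.midWeight k X φ = C'' * (P.aFactor k X * P.W.midWeight k X φ) :=
    fun C'' => mul_assoc _ _ _
  rw [e]
  exact le_mul_of_forall_lt_mul fun C' hC' => by rw [← e]; exact h C' hC' X hX hc φ

/-- **The engine's closure hypothesis `hQc` for `Q = activityNormLE P`**: for every scale `k`,
activity `K` and bound `c`, if `‖K‖_k^{(A)} ≤ c'` for all `c' > c` then `‖K‖_k^{(A)} ≤ c` — verbatim the
hypothesis `hQc` of `RGFlow.distQ_le_of_isTunedQ` / `RGFlow.secondDiff_le_of_isTunedQ`.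
[cite: AdamsBuchholzKoteckyMuller2019, Ch. 12 (12.2)] -/
theorem activityNormLE_of_forall_lt (P : NormParams d M) :
    ∀ (k : ℕ) (K : activitySpace P k) (c : ℝ), (∀ c', c < c' → activityNormLE P k K c') →
      activityNormLE P k K c :=
  fun _ _ _ h => WeakNormLE.of_forall_lt h

end Polymer

end Literature.MathematicalPhysics.StatisticalMechanics.GradientRG

end
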